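/-
Copyright (c) 2026. Released under the Apache 2.0 license.
-/
import Literature.NumberTheory.EllipticCurves.ManinConstantClassCertificateTwist
import Literature.NumberTheory.EllipticCurves.ManinConstantQuadraticTwistGamma0Proofs
import Literature.NumberTheory.EllipticCurves.ManinConstantQuadraticTwistStevensHoldsProofs
import Literature.NumberTheory.EllipticCurves.ManinConstantQuadraticTwistIstarProofs
import Literature.NumberTheory.Automorphic.ShimuraCurveRibetTakahashiOptimalModularityProofs
import HarnessLib

/-!
# The twist-covered class certificate with the SHORT binder list: the `Γ₀` road
# (`IsEdixhovenCesnaviciusTwistCovered W ⟹ ClassAbsManinConstantEqOne W` modulo `hM hAU hC hEA hEB hnf`)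

[Proofs] Theorems only (no definition, no named fact; D-0026). Topic
`Literature/NumberTheory/EllipticCurves`; namespace `Literature.NumberTheory.EllipticCurves.ModularForms`.

`ManinConstantClassCertificateTwist.lean` defines the per-(member, prime) hypothesis
`TwistSemistableWitnessAt W' q` (a displayed witness `V`, globally minimal, with
`W' ∼ V ⊗ χ_{q*}`, `N(V) ∣ N(W')`, `N(V)·q ∣ N(W')`, `q² ∤ N(V)`, `W'` additive at `q`, and a
torsion clause at `q ≤ 7`) and the class predicate `IsEdixhovenCesnaviciusTwistCovered W`, and
proves `ClassAbsManinConstantEqOne W` for covered classes along the `X₁(N)` road of Stevens 1989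
§5 / Česnavičius 2018 Lemma 2.12 — modulo ELEVEN named inputs (`hM hAU hC hEA hEB hnf` and
`h14` Stevens (1.4), `h52` Stevens (5.2), `hNS` Néron scaling, `h212` Česnavičius 2.12, `h65` ČNS 6.5,
`hMz` Mazur's torsion theorem).

This file proves THE SAME CONCLUSIONS FROM THE SAME PREDICATES along the `Γ₀` road of
`ManinConstantQuadraticTwistGamma0Proofs.lean` (`c₀(𝒜) ∣ c(D')` directly from the `Γ₀` twisting
theorem `gaussSum_mul_mem_periodLattice_of_mem_charTwist`, the Néron-scaling THEOREM
`integral_neronScaling_of_isGloballyMinimal_holds`, Stevens' Lemma (5.2) as the THEOREM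
`stevens1989_neronLattice_quadraticTwist_oddPrime_holds`, and the optimal `X₀`-datum of the twisted
class from modularity, `exists_optimal_modularParametrizationData_of_isNewformOf'` +
`latticeEq_of_forall_modularDegree_le`), so that the binder list shrinks to the six inputs of the
Edixhoven constructor (`hM hAU hC hEA hEB hnf`) — and to FOUR (`hM hAU hC hnf`) on the twist
disjunct alone: NO `X₁(N)`-data (`h14`), NO Shimura cover (`h212`, `h65`), NO torsion clause
(`hMz`; the clause inside `TwistSemistableWitnessAt` is simply not used), `h52`/`hNS` discharged.

* `not_dvd_maninConstant_of_isTwistOfSemistableAt_gamma0` — the per-(class, prime) certificate: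
  `W ∼ W' ⊗ χ_{q*}` with `W'` globally minimal, `N(W') ∣ N(W)`, `q² ∣ N(W)`, `q² ∤ N(W')`, `W`
  additive at `q` ⟹ every lattice-optimal `X₀`-datum of every globally minimal `W₀ ∼ W` has
  `q ∤ c`. (Compared with `not_dvd_maninConstant_of_isTwistOfSemistableAt`: no `N(W')·q ∣ N(W)`,
  no torsion hypothesis, binders `hM hAU hC2 hnf` only.)
* `not_dvd_maninConstant_of_twistSemistableWitnessAt_gamma0` — from `TwistSemistableWitnessAt W' q`.
* `classAbsManinConstantEqOne_of_isEdixhovenCesnaviciusTwistCovered_gamma0` and the binder form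
  `not_dvd_maninConstant_of_isEdixhovenCesnaviciusTwistCovered_gamma0` — the class certificate,
  binders `hM hAU hC hEA hEB hnf` (the Edixhoven facts serve the left disjunct only).
* `classAbsManinConstantEqOne_of_forall_sq_prime_edixhoven_or_kodairaIstar_or_twist_gamma0` — the
  KODAIRA-KEYED class certificate: at each square prime `p` of each globally minimal member `W'`,
  EITHER `p > 7` and `W'` is Edixhoven-nonexceptional, OR `p` is odd and the Kodaira symbol of `W'`
  at `p` is `Iₙ*` for some `n ≥ 0` (`not_dvd_maninConstant_of_kodairaSymbolAt_eq_Istar` of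
  `ManinConstantQuadraticTwistIstarProofs.lean`: no twist witness, no torsion clause, every odd
  `p`), OR a twist witness `TwistSemistableWitnessAt W' p` is displayed. The hypothesis is spelled
  out (no new predicate); same six binders.

## References
* [Stevens1989] G. Stevens, Invent. Math. 98 (1989), Lemmas (5.2), (5.4) (`Γ₀` form of the
  twisting argument; Shimura 1971 Prop. 3.64).
* [EdixhovenManin1991] B. Edixhoven, Progr. Math. 89 (1991), §1 (typescript L96–101) and Thm. 3.
* [Cesnavicius2018] K. Česnavičius, Compositio Math. 154 (2018), Thm. 1.2.
* [Mazur1978] B. Mazur, Invent. Math. 44 (1978), Cor. 4.1.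
* [AbbesUllmo1996] A. Abbes, E. Ullmo, Compositio Math. 103 (1996), Thm. A.
-/

noncomputable section

open scoped MatrixGroups ModularForm

open CongruenceSubgroup WeierstrassCurve Literature.NumberTheory.Automorphic

namespace Literature.NumberTheory.EllipticCurves.ModularForms

/-! ### The per-(class, prime) certificate on `Γ₀` -/

section Certificate

variable {W : WeierstrassCurve ℚ} [W.IsElliptic]
  {W' : WeierstrassCurve ℚ} [W'.IsElliptic] [W'.IsGloballyMinimal]

/-- **`q ∤ c₀(𝒜)` for a class `𝒜` that is the `χ_{q*}`-twist of a class `𝒜'` semistable at the odd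
prime `q` — `Γ₀` road, short binder list.** Hypotheses: `W ∈ 𝒜` (any model), `W' ∈ 𝒜'` globally
minimal, `W ∼ W'.quadraticTwist q*`; `N(W') ∣ N(W)`, `q² ∣ N(W)`, `q² ∤ N(W')`; `W` additive at
`q`. Conclusion: every lattice-optimal `X₀`-datum `D₀` of every globally minimal `W₀ ∼ W` has
`q ∤ D₀.maninConstant`. Proof: the optimal `X₀`-datum `D'` of `𝒜'` exists by modularity
(`exists_optimal_modularParametrizationData_of_isNewformOf'`, lattice-optimal by
`latticeEq_of_forall_modularDegree_le`) on a globally minimal `W₁'` with `N(W₁') = N(W')`, hence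
semistable at `q`; `aₙ(f_{D₀}) = (n/q)·aₙ(f_{D'})` (isogeny invariance of `L`,
`LFunction_quadraticTwist_pStar_apply` away from `q`, additivity of `W` at the multiples of `q`);
then `not_dvd_maninConstant_of_twist_gamma0_of_stevens` with Stevens (5.2) PROVED. Facts consumed
by name: `hM`, `hAU`, `hC2`, `hnf` only. [cite: Stevens1989, Lemmas (5.2), (5.4)]
[cite: Cesnavicius2018, Thm. 1.2] [cite: Mazur1978, Cor. 4.1] [cite: EdixhovenManin1991, §1] -/
theorem not_dvd_maninConstant_of_isTwistOfSemistableAt_gamma0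
    (hM : mazur_not_dvd_maninConstant_of_odd)
    (hAU : abbesUllmo_not_dvd_maninConstant_of_not_dvd_level)
    (hC2 : cesnavicius_not_two_dvd_maninConstant_of_two_dvd_level) (hnf : exists_isNewformOf)
    {q : ℕ} [Fact q.Prime] (hq2 : q ≠ 2)
    (htw : IsIsogenous W (W'.quadraticTwist (((-1 : ℤ) ^ (q / 2) * q : ℤ) : ℚ)))
    (hN'N : W'.conductorNorm ℤ ∣ W.conductorNorm ℤ) (hqN : q ^ 2 ∣ W.conductorNorm ℤ)
    (hqN' : ¬ q ^ 2 ∣ W'.conductorNorm ℤ)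
    (hadd : ¬ W.HasGoodReductionAtPrime q ∧ ¬ W.HasMultiplicativeReductionAtPrime q)
    (W₀ : WeierstrassCurve ℚ) [W₀.IsElliptic] [W₀.IsGloballyMinimal] {N₀ : ℕ} [NeZero N₀]
    (D₀ : ModularParametrizationData W₀ N₀) (hiso : IsIsogenous W W₀)
    (h₀ : ∀ z ∈ D₀.L.lattice, ∃ w ∈ periodLattice D₀.f, z = D₀.c * w) :
    ¬ (q : ℤ) ∣ D₀.maninConstant := by
  have hqp : q.Prime := Fact.out
  have hd0 : ((((-1 : ℤ) ^ (q / 2) * q : ℤ)) : ℚ) ≠ 0 := by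
    push_cast
    exact mul_ne_zero (pow_ne_zero _ (by norm_num)) (by exact_mod_cast hqp.ne_zero)
  -- the levels are the conductors
  have hLW₀ : W.LFunction = W₀.LFunction := LFunction_eq_of_isIsogenous_holds W W₀ hiso
  have hnfW : IsNewformOf W D₀.f :=
    ⟨D₀.isNewformOf.1, fun n ↦ by rw [D₀.isNewformOf.2 n, hLW₀]⟩
  have hN₀ : N₀ = W.conductorNorm ℤ :=
    IsNewformOf.level_eq_conductorNorm_of_exists_isNewformOf hnf hnfW
  haveI : NeZero (W'.conductorNorm ℤ) := ⟨(conductorNorm_pos_holds W').ne'⟩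
  -- the optimal `X₀`-datum `D'` of `𝒜'`, on a globally minimal `W₁' ∼ W'`
  obtain ⟨f', hf'⟩ := hnf W'
  obtain ⟨W₁', hE₁', hM₁', D', hD'f, -, hmin⟩ :=
    exists_optimal_modularParametrizationData_of_isNewformOf' (W'.conductorNorm ℤ) W' rfl hf'
  haveI := hE₁'
  haveI := hM₁'
  have hopt' : ∀ z ∈ D'.L.lattice, ∃ w ∈ periodLattice D'.f, z = D'.c * w :=
    D'.latticeEq_of_forall_modularDegree_le fun W₂ _ D₂ h2 ↦ hmin W₂ D₂ (h2.trans hD'f)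
  -- `W₁'` is semistable at `q`: its conductor is the level `N(W')`, and `q² ∤ N(W')`
  have hN'₁ : W'.conductorNorm ℤ = W₁'.conductorNorm ℤ :=
    IsNewformOf.level_eq_conductorNorm_of_exists_isNewformOf hnf D'.isNewformOf
  have hsemi : W₁'.HasGoodReductionAtPrime q ∨ W₁'.HasMultiplicativeReductionAtPrime q :=
    hasGoodReductionAtPrime_or_hasMultiplicativeReductionAtPrime_of_not_sq_dvd_conductorNorm
      (by rw [← hN'₁]; exact hqN')
  -- the minimal model `C` of `W₁' ⊗ χ_{q*}` and a Néron pair of it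
  haveI : (W₁'.quadraticTwist (((-1 : ℤ) ^ (q / 2) * q : ℤ) : ℚ)).IsElliptic :=
    W₁'.isElliptic_quadraticTwist hd0
  obtain ⟨vC, hvC⟩ := hasGlobalMinimalModel_rat_holds
    (W₁'.quadraticTwist (((-1 : ℤ) ^ (q / 2) * q : ℤ) : ℚ))
  haveI := hvC
  haveI : ((vC • W₁'.quadraticTwist (((-1 : ℤ) ^ (q / 2) * q : ℤ) : ℚ)).baseChange ℂ).IsElliptic := by
    rw [WeierstrassCurve.baseChange]; infer_instance
  obtain ⟨LC, hC⟩ := exists_isNeronLatticeOf_holds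
    ((vC • W₁'.quadraticTwist (((-1 : ℤ) ^ (q / 2) * q : ℤ) : ℚ)).baseChange ℂ)
  -- the Legendre character and Gauss's evaluation
  have hχq := isQuadratic_quadraticChar_ringHomComp q
  have hχp := isPrimitive_quadraticChar_ringHomComp q hq2
  have hG := gaussSum_quadraticChar_ringHomComp_sq q hq2
  -- the newform of `𝒜` is the `(·/q)`-twist of that of `𝒜'`
  have hLtw : W.LFunction =
      (W'.quadraticTwist (((-1 : ℤ) ^ (q / 2) * q : ℤ) : ℚ)).LFunction := by
    haveI : (W'.quadraticTwist (((-1 : ℤ) ^ (q / 2) * q : ℤ) : ℚ)).IsElliptic :=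
      W'.isElliptic_quadraticTwist hd0
    exact LFunction_eq_of_isIsogenous_holds _ _ htw
  have hf : ∀ n : ℕ, cuspCoeff D₀.f n =
      (quadraticChar (ZMod q)).ringHomComp (Int.castRingHom ℂ) n * cuspCoeff D'.f n := by
    intro n
    have hLn : W₀.LFunction n = W.LFunction n := by rw [hLW₀]
    rw [D₀.isNewformOf.2 n, hD'f, hf'.2 n, hLn, quadraticChar_ringHomComp_apply_natCast q n]
    by_cases hqn : q ∣ n
    · have h0 : W.LFunction n = 0 :=
        W.LFunction_apply_eq_zero_of_not_good_of_not_mult q hadd.1 hadd.2 hqn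
      have hl : legendreSym q n = 0 := (legendreSym.eq_zero_iff q n).mpr (by
        rw [ZMod.intCast_zmod_eq_zero_iff_dvd]
        exact_mod_cast hqn)
      rw [h0, hl]
      simp
    · have hLn' : W.LFunction n =
          (W'.quadraticTwist (((-1 : ℤ) ^ (q / 2) * q : ℤ) : ℚ)).LFunction n := by rw [hLtw]
      rw [hLn', W'.LFunction_quadraticTwist_pStar_apply hq2 hqn]
      have hne : ((n : ℤ) : ZMod q) ≠ 0 := by
        rw [Int.cast_natCast, Ne, ZMod.natCast_eq_zero_iff]
        exact hqn
      push_cast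
      rcases legendreSym.eq_one_or_neg_one q hne with h1 | h1
      · rw [show (legendreSym q (n : ℤ)) = legendreSym q n from rfl, h1]
      · rw [show (legendreSym q (n : ℤ)) = legendreSym q n from rfl, h1]
  -- conductor bookkeeping at level `N₀ = N(W)`
  have hN : W'.conductorNorm ℤ ∣ N₀ := by rw [hN₀]; exact hN'N
  have hm : q ^ 2 ∣ N₀ := by rw [hN₀]; exact hqN
  have hqN'₁ : ¬ q ^ 2 ∣ W'.conductorNorm ℤ := hqN'
  exact not_dvd_maninConstant_of_twist_gamma0_of_stevens (C := vC • W₁'.quadraticTwist _)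
    stevens1989_neronLattice_quadraticTwist_oddPrime_holds hM hAU hC2 D₀ h₀ D' hopt' hq2 hχq hχp
    hG hN hm hf hsemi ⟨vC, rfl⟩ hC hqN'₁

end Certificate

/-! ### From the displayed witness, and the class certificate -/

/-- **Per prime, per member, from the displayed witness**: `TwistSemistableWitnessAt W' q` gives
`q ∤ D'.maninConstant` for every lattice-optimal `X₀`-datum `D'` of the globally minimal `W'` —
on the `Γ₀` road, binders `hM hAU hC2 hnf` only (the witness's torsion clause and `N(V)·q ∣ N(W')`
are not used). [cite: Stevens1989, Lemmas (5.2), (5.4)] [cite: Cesnavicius2018, Thm. 1.2]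
[cite: EdixhovenManin1991, §1] -/
theorem not_dvd_maninConstant_of_twistSemistableWitnessAt_gamma0
    (hM : mazur_not_dvd_maninConstant_of_odd)
    (hAU : abbesUllmo_not_dvd_maninConstant_of_not_dvd_level)
    (hC2 : cesnavicius_not_two_dvd_maninConstant_of_two_dvd_level) (hnf : exists_isNewformOf)
    (W' : WeierstrassCurve ℚ) [W'.IsElliptic] [W'.IsGloballyMinimal] {N' : ℕ} [NeZero N']
    (D' : ModularParametrizationData W' N')
    (hopt : ∀ z ∈ D'.L.lattice, ∃ w ∈ periodLattice D'.f, z = D'.c * w)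
    {q : ℕ} [Fact q.Prime] (htw : TwistSemistableWitnessAt W' q) :
    ¬ (q : ℤ) ∣ D'.maninConstant := by
  obtain ⟨hq2, V, hVE, hVM, hiso, hdvd, -, hsq, hadd, -⟩ := htw
  haveI := hVE
  haveI := hVM
  exact not_dvd_maninConstant_of_isTwistOfSemistableAt_gamma0 hM hAU hC2 hnf hq2 hiso hdvd
    (sq_dvd_conductorNorm_of_not_good_of_not_mult hadd) hsq hadd W' D' (IsIsogenous.refl_holds W')
    hopt

/-- **Edixhoven 1991 Thm. 3 OR the twist road at each square prime, + Česnavičius 2018 Thm. 1.2 at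
the others, per class — `Γ₀` road, binders `hM hAU hC hEA hEB hnf`** (the Edixhoven facts `hEA`,
`hEB` serve the left disjunct only). Same predicate and conclusion as
`classAbsManinConstantEqOne_of_isEdixhovenCesnaviciusTwistCovered`, six named inputs instead of
eleven. [cite: EdixhovenManin1991, §1 and Thm. 3] [cite: Cesnavicius2018, Thm. 1.2]
[cite: Stevens1989, Lemmas (5.2), (5.4)] [cite: Mazur1978, Cor. 4.1] [cite: AbbesUllmo1996, Thm. A] -/
theorem classAbsManinConstantEqOne_of_isEdixhovenCesnaviciusTwistCovered_gamma0
    (hM : mazur_not_dvd_maninConstant_of_odd)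
    (hAU : abbesUllmo_not_dvd_maninConstant_of_not_dvd_level)
    (hC : cesnavicius_not_two_dvd_maninConstant_of_two_dvd_level)
    (hEA : edixhoven_not_dvd_maninConstant_of_not_potentiallyGoodOrdinary)
    (hEB : edixhoven_not_dvd_maninConstant_of_kodairaSymbol_ne)
    (hnf : exists_isNewformOf)
    (W : WeierstrassCurve ℚ) (hcov : IsEdixhovenCesnaviciusTwistCovered W) :
    ClassAbsManinConstantEqOne W := by
  intro W' _ _ N' _ D' hiso hopt
  have hN' : N' = W'.conductorNorm ℤ :=
    IsNewformOf.level_eq_conductorNorm_of_exists_isNewformOf hnf D'.isNewformOf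
  subst hN'
  refine D'.abs_maninConstant_eq_one_of_forall_prime_not_dvd fun p hp ↦ ?_
  by_cases hsq : p ^ 2 ∣ W'.conductorNorm ℤ
  · rcases hcov W' hiso p hp hsq with ⟨h7, hne | hG⟩ | htw
    · exact hEB W' D' hopt p hp h7 hne.1 hne.2.1 hne.2.2
    · exact hEA W' D' hopt p hp h7 hG
    · haveI : Fact p.Prime := ⟨hp⟩
      exact not_dvd_maninConstant_of_twistSemistableWitnessAt_gamma0 hM hAU hC hnf W' D' hopt htw
  · exact cesnavicius2018_not_dvd_maninConstant_of_not_sq_dvd_level hM hAU hC W' D' hopt hp hsq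

/-- The binder form carried by consumers (`Γ₀` road): for a twist-covered class, `p ∤ c` for EVERY
prime `p` and every optimal datum of every globally minimal member, modulo `hM hAU hC hEA hEB hnf`.
[cite: EdixhovenManin1991, §1 and Thm. 3] [cite: Cesnavicius2018, Thm. 1.2] -/
theorem not_dvd_maninConstant_of_isEdixhovenCesnaviciusTwistCovered_gamma0
    (hM : mazur_not_dvd_maninConstant_of_odd)
    (hAU : abbesUllmo_not_dvd_maninConstant_of_not_dvd_level)
    (hC : cesnavicius_not_two_dvd_maninConstant_of_two_dvd_level)
    (hEA : edixhoven_not_dvd_maninConstant_of_not_potentiallyGoodOrdinary)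
    (hEB : edixhoven_not_dvd_maninConstant_of_kodairaSymbol_ne)
    (hnf : exists_isNewformOf)
    {W : WeierstrassCurve ℚ} (hcov : IsEdixhovenCesnaviciusTwistCovered W)
    (W' : WeierstrassCurve ℚ) [W'.IsElliptic] [W'.IsGloballyMinimal] {N' : ℕ} [NeZero N']
    (D' : ModularParametrizationData W' N') (hiso : IsIsogenous W W')
    (hopt : ∀ z ∈ D'.L.lattice, ∃ w ∈ periodLattice D'.f, z = D'.c * w)
    (p : ℕ) (hp : p.Prime) : ¬ (p : ℤ) ∣ D'.maninConstant :=
  (classAbsManinConstantEqOne_of_isEdixhovenCesnaviciusTwistCovered_gamma0 hM hAU hC hEA hEB hnf W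
    hcov).not_dvd_maninConstant D' hiso hopt hp

/-! ### The Kodaira-keyed class certificate -/

/-- **Edixhoven 1991 Thm. 3, OR Kodaira type `Iₙ*` at an odd prime, OR a displayed twist witness —
at each square prime; Česnavičius 2018 Thm. 1.2 at the others. `Γ₀` road, binders
`hM hAU hC hEA hEB hnf`.** For a class all of whose globally minimal members `W'` satisfy, at every
prime `p` with `p² ∣ N(W')`: `p > 7` and `EdixhovenNonexceptionalAt W' p` (served by `hEA`/`hEB`),
or `p ≠ 2` and `W'.kodairaSymbolAt (p) = Iₙ*` for some `n` (served by the THEOREM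
`not_dvd_maninConstant_of_kodairaSymbolAt_eq_Istar`: `W' ⊗ χ_{p*}` is good (`n = 0`) or
multiplicative (`n ≥ 1`) at `p`), or `TwistSemistableWitnessAt W' p` (served by
`not_dvd_maninConstant_of_twistSemistableWitnessAt_gamma0`), the class has `|c| = 1` for every
optimal `X₀`-datum of every globally minimal member. The middle disjunct is read off Tate's
algorithm at `p` alone (no witness curve, no torsion clause, every odd `p` including `3, 5, 7`).
[cite: EdixhovenManin1991, §1 and Thm. 3] [cite: Cesnavicius2018, Thm. 1.2]
[cite: Stevens1989, Lemmas (5.2), (5.4)] [cite: SilvermanATAEC1994, IV.11.1 table p. 368]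
[cite: Mazur1978, Cor. 4.1] [cite: AbbesUllmo1996, Thm. A] -/
theorem classAbsManinConstantEqOne_of_forall_sq_prime_edixhoven_or_kodairaIstar_or_twist_gamma0
    (hM : mazur_not_dvd_maninConstant_of_odd)
    (hAU : abbesUllmo_not_dvd_maninConstant_of_not_dvd_level)
    (hC : cesnavicius_not_two_dvd_maninConstant_of_two_dvd_level)
    (hEA : edixhoven_not_dvd_maninConstant_of_not_potentiallyGoodOrdinary)
    (hEB : edixhoven_not_dvd_maninConstant_of_kodairaSymbol_ne)
    (hnf : exists_isNewformOf)
    (W : WeierstrassCurve ℚ)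
    (hcov : ∀ (W' : WeierstrassCurve ℚ) [W'.IsElliptic] [W'.IsGloballyMinimal], IsIsogenous W W' →
      ∀ (p : ℕ) (hp : p.Prime), p ^ 2 ∣ W'.conductorNorm ℤ →
        (7 < p ∧ EdixhovenNonexceptionalAt W' p hp) ∨
        (p ≠ 2 ∧ ∃ n : ℕ,
          W'.kodairaSymbolAt ((Rat.HeightOneSpectrum.primesEquiv (R := ℤ)).symm ⟨p, hp⟩) = .Istar n) ∨
        @TwistSemistableWitnessAt W' p ⟨hp⟩) :
    ClassAbsManinConstantEqOne W := by
  intro W' _ _ N' _ D' hiso hopt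
  have hN' : N' = W'.conductorNorm ℤ :=
    IsNewformOf.level_eq_conductorNorm_of_exists_isNewformOf hnf D'.isNewformOf
  subst hN'
  refine D'.abs_maninConstant_eq_one_of_forall_prime_not_dvd fun p hp ↦ ?_
  by_cases hsq : p ^ 2 ∣ W'.conductorNorm ℤ
  · rcases hcov W' hiso p hp hsq with ⟨h7, hne | hG⟩ | ⟨hp2, n, hK⟩ | htw
    · exact hEB W' D' hopt p hp h7 hne.1 hne.2.1 hne.2.2
    · exact hEA W' D' hopt p hp h7 hG
    · exact not_dvd_maninConstant_of_kodairaSymbolAt_eq_Istar hM hAU hC hnf D' hopt hp hp2 hK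
    · haveI : Fact p.Prime := ⟨hp⟩
      exact not_dvd_maninConstant_of_twistSemistableWitnessAt_gamma0 hM hAU hC hnf W' D' hopt htw
  · exact cesnavicius2018_not_dvd_maninConstant_of_not_sq_dvd_level hM hAU hC W' D' hopt hp hsq

/-- **Kodaira-only form** (no Edixhoven facts among the USED binders, though they are carried for a
uniform signature — here dropped): if at every square prime `p` of every globally minimal member the
prime is odd and the Kodaira symbol is `Iₙ*`, the class has `|c| = 1`, modulo `hM hAU hC hnf` only.
[cite: Stevens1989, Lemmas (5.2), (5.4)] [cite: Cesnavicius2018, Thm. 1.2]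
[cite: SilvermanATAEC1994, IV.11.1 table p. 368] [cite: Mazur1978, Cor. 4.1] -/
theorem classAbsManinConstantEqOne_of_forall_sq_prime_kodairaIstar_gamma0
    (hM : mazur_not_dvd_maninConstant_of_odd)
    (hAU : abbesUllmo_not_dvd_maninConstant_of_not_dvd_level)
    (hC : cesnavicius_not_two_dvd_maninConstant_of_two_dvd_level)
    (hnf : exists_isNewformOf)
    (W : WeierstrassCurve ℚ)
    (hcov : ∀ (W' : WeierstrassCurve ℚ) [W'.IsElliptic] [W'.IsGloballyMinimal], IsIsogenous W W' →
      ∀ (p : ℕ) (hp : p.Prime), p ^ 2 ∣ W'.conductorNorm ℤ →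
        p ≠ 2 ∧ ∃ n : ℕ,
          W'.kodairaSymbolAt ((Rat.HeightOneSpectrum.primesEquiv (R := ℤ)).symm ⟨p, hp⟩) = .Istar n) :
    ClassAbsManinConstantEqOne W := by
  intro W' _ _ N' _ D' hiso hopt
  have hN' : N' = W'.conductorNorm ℤ :=
    IsNewformOf.level_eq_conductorNorm_of_exists_isNewformOf hnf D'.isNewformOf
  subst hN'
  refine D'.abs_maninConstant_eq_one_of_forall_prime_not_dvd fun p hp ↦ ?_
  by_cases hsq : p ^ 2 ∣ W'.conductorNorm ℤ
  · obtain ⟨hp2, n, hK⟩ := hcov W' hiso p hp hsq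
    exact not_dvd_maninConstant_of_kodairaSymbolAt_eq_Istar hM hAU hC hnf D' hopt hp hp2 hK
  · exact cesnavicius2018_not_dvd_maninConstant_of_not_sq_dvd_level hM hAU hC W' D' hopt hp hsq

end Literature.NumberTheory.EllipticCurves.ModularForms

end
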